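import Mathlib.LinearAlgebra.Matrix.Permanent
import Mathlib.LinearAlgebra.Matrix.Determinant.Basic
import Mathlib.Data.Real.Basic

/-!
# Route SliceSignRank — crux `SrkNotQP` (stmt-ValiantsHypothesis-20857): a kernel-checked
# two-twist sign-representation of `sgn` on `S_4` (`srk(4) ≤ 2`) and its isotropy data

The route file cites `srk(4) = 2 < 3` ("cancellations help", why-it-might-fail of `SrkNotQP` /
`SignRankSuperQP`) from a kit computation (j003249) and notes that the finite values of `srk` had
"no Lean certificate format yet".  Upper bounds DO have one: an explicit witness checked by
`decide`.  This file lands the INTEGER witness found in the isotropy census of line `forster_slice`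
(`Cruxes/SrkNotQP/IsotropyCensusP2.md`):

  `A = [[1,−2,1,2],[2,1,−2,1],[−2,1,−1,2],[−1,−2,−2,−1]]`,
  `B = [[2,1,−2,−1],[1,−2,1,−2],[1,2,2,−1],[−2,1,−1,−2]]`   (rows `a`, columns `i`),

`F(σ) = Π_i A(σ i, i) + Π_i B(σ i, i)` has `sgn(σ) · F(σ) ∈ {6, 8, 17}` for all `24` permutations
(`two_twists_signRep_four_int`), hence (`exists_two_twists_signRep_four`) the inner predicate of
`SrkNotQP` / `SignRankSuperQP` HOLDS at `n = 4, k = 2`, and the `∃ n` of `SrkNotQP` is never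
witnessed by `n = 4` (`srkNotQP_not_witnessed_at_four`; calibration only — the crux is about large
`n`).

ISOTROPY DATA (`two_twists_four_data`, all by `decide` over `ℤ`): `det A = det B = 98` (as Leibniz
sums; `two_twists_four_det`), `per(A∘A) = per(B∘B) = 1122`, Gram cross term `per(A ⊙ B) = −128`,
total mass `Σ_σ |F(σ)| = 196 = det A + det B`, `‖F‖₂² = 1988`.  So the isotropy constant of the
landed `forsterSlice_of_isotropyConstant` (p582926) is `K = 4!·(1122+1122)/196² ≈ 1.402 < k = 2`
(below Forster's matrix value `K = k`), and that theorem's conclusion `n!·per(V∘V) ≤ K·k·det(V)²`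
holds here with EQUALITY for both twists (`24·1122·196² = 24·2244·2·98²`,
`two_twists_four_forster_tight`) — a third sharp instance besides Leibniz (`k = n!`) and `n = 2`.

Honest framing: a finite calibration witness; `SrkNotQP`, `SignRankSuperQP`, `stub_forsterSlice`
remain OPEN and `VP ≠ VNP` is not touched.  No `def`s (the matrices are bound by hypotheses
`hA : A = !![…]`), no `native_decide`.
-/

-- Sub = Summit layout duplicates the namespace component
set_option linter.dupNamespace false

namespace Summit.ValiantsHypothesis.ValiantsHypothesis.Theorems.SliceSignRank.SrkNotQP

open Equiv

/-- **The integer witness**: for the two `4 × 4` integer twists `A, B` of the module docstring,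
`sgn(σ) · (Π_i A(σ i, i) + Π_i B(σ i, i)) ≥ 6 > 0` for every `σ ∈ S_4`.
Kernel-checked by `decide` (24 permutations). [this file; witness from the isotropy census] -/
theorem two_twists_signRep_four_int (A B : Matrix (Fin 4) (Fin 4) ℤ)
    (hA : A = !![1, -2, 1, 2; 2, 1, -2, 1; -2, 1, -1, 2; -1, -2, -2, -1])
    (hB : B = !![2, 1, -2, -1; 1, -2, 1, -2; 1, 2, 2, -1; -2, 1, -1, -2]) :
    ∀ σ : Perm (Fin 4), 6 ≤ ((Perm.sign σ : ℤˣ) : ℤ) * ((∏ i, A (σ i) i) + ∏ i, B (σ i) i) := by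
  subst hA hB
  decide

/-- **`srk(4) ≤ 2`, in the route's vocabulary**: two real twists sign-represent `sgn` on `S_4`,
i.e. the inner predicate
`∃ W : Fin k → Matrix (Fin n) (Fin n) ℝ, ∀ σ, 0 < sgn σ · Σ_t Π_i W_t(σ i, i)` of `SrkNotQP` / `SignRankSuperQP` holds at `n = 4`, `k = 2` (cast of the integer witness).
[this file] -/
theorem exists_two_twists_signRep_four :
    ∃ W : Fin 2 → Matrix (Fin 4) (Fin 4) ℝ,
      ∀ σ : Perm (Fin 4), 0 < ((Perm.sign σ : ℤ) : ℝ) * ∑ t, ∏ i, W t (σ i) i := by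
  set A : Matrix (Fin 4) (Fin 4) ℤ := !![1, -2, 1, 2; 2, 1, -2, 1; -2, 1, -1, 2; -1, -2, -2, -1]
    with hA
  set B : Matrix (Fin 4) (Fin 4) ℤ := !![2, 1, -2, -1; 1, -2, 1, -2; 1, 2, 2, -1; -2, 1, -1, -2]
    with hB
  refine ⟨![A.map (Int.cast : ℤ → ℝ), B.map (Int.cast : ℤ → ℝ)], fun σ => ?_⟩
  have h := two_twists_signRep_four_int A B hA hB σ
  have h' : (0 : ℤ) < ((Perm.sign σ : ℤˣ) : ℤ) * ((∏ i, A (σ i) i) + ∏ i, B (σ i) i) := by omega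
  have hcast : ((Perm.sign σ : ℤ) : ℝ) * ∑ t, ∏ i, (![A.map (Int.cast : ℤ → ℝ),
      B.map (Int.cast : ℤ → ℝ)] : Fin 2 → Matrix (Fin 4) (Fin 4) ℝ) t (σ i) i =
      ((((Perm.sign σ : ℤˣ) : ℤ) * ((∏ i, A (σ i) i) + ∏ i, B (σ i) i) : ℤ) : ℝ) := by
    push_cast
    simp [Fin.sum_univ_two, Matrix.map_apply]
  rw [hcast]
  exact_mod_cast h'

/-- **Calibration of the binder**: the `∃ n` of `SrkNotQP` is never witnessed by `n = 4` — for
every `c`, `k = 2 ≤ 2^((log₂ 4 + c)^c)` twists DO sign-represent `sgn` on `S_4`.  (The crux is a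
statement about large `n`; this only records where the small-`n` data sits.) [this file] -/
theorem srkNotQP_not_witnessed_at_four (c : ℕ) :
    ¬ ∀ k ≤ 2 ^ ((Nat.log 2 4 + c) ^ c), ¬ ∃ W : Fin k → Matrix (Fin 4) (Fin 4) ℝ,
      ∀ σ : Perm (Fin 4), 0 < ((Perm.sign σ : ℤ) : ℝ) * ∑ t, ∏ i, W t (σ i) i := by
  intro h
  have h2 : 2 ≤ 2 ^ ((Nat.log 2 4 + c) ^ c) := by
    calc 2 = 2 ^ 1 := by norm_num
      _ ≤ 2 ^ ((Nat.log 2 4 + c) ^ c) :=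
          Nat.pow_le_pow_right two_pos
            (Nat.one_le_pow _ _ (Nat.add_pos_left (Nat.log_pos one_lt_two (by norm_num)) c))
  exact h 2 h2 exists_two_twists_signRep_four

/-- **Isotropy data of the witness** (exact integers, by `decide`): the Leibniz sums
`Σ_σ sgn σ Π_i A(σ i, i) = Σ_σ sgn σ Π_i B(σ i, i) = 98` (`= det A = det B`), the squared norms
`Σ_σ (Π_i A(σ i,i))² = Σ_σ (Π_i B(σ i,i))² = 1122` (`= per(A∘A) = per(B∘B)`), the Gram cross term
`Σ_σ Π_i A(σ i,i) Π_i B(σ i,i) = −128` (`= per(A ⊙ B)`), the total mass `Σ_σ |F(σ)| = 196` and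
`‖F‖₂² = Σ_σ F(σ)² = 1988`.  Hence isotropy constant `K = 24·2244/196² ≈ 1.402`, `L²` isotropy
defect `B = 2244/1988 ≈ 1.129`, sup-flatness `B' = 24·289/1988 ≈ 3.489`. [this file] -/
theorem two_twists_four_data (A B : Matrix (Fin 4) (Fin 4) ℤ)
    (hA : A = !![1, -2, 1, 2; 2, 1, -2, 1; -2, 1, -1, 2; -1, -2, -2, -1])
    (hB : B = !![2, 1, -2, -1; 1, -2, 1, -2; 1, 2, 2, -1; -2, 1, -1, -2]) :
    (∑ σ : Perm (Fin 4), ((Perm.sign σ : ℤˣ) : ℤ) * ∏ i, A (σ i) i) = 98 ∧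
    (∑ σ : Perm (Fin 4), ((Perm.sign σ : ℤˣ) : ℤ) * ∏ i, B (σ i) i) = 98 ∧
    (∑ σ : Perm (Fin 4), (∏ i, A (σ i) i) ^ 2) = 1122 ∧
    (∑ σ : Perm (Fin 4), (∏ i, B (σ i) i) ^ 2) = 1122 ∧
    (∑ σ : Perm (Fin 4), (∏ i, A (σ i) i) * ∏ i, B (σ i) i) = -128 ∧
    (∑ σ : Perm (Fin 4), |(∏ i, A (σ i) i) + ∏ i, B (σ i) i|) = 196 ∧
    (∑ σ : Perm (Fin 4), ((∏ i, A (σ i) i) + ∏ i, B (σ i) i) ^ 2) = 1988 := by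
  subst hA hB
  refine ⟨?_, ?_, ?_, ?_, ?_, ?_, ?_⟩ <;> decide

/-- The witness's determinants, as `Matrix.det` (Leibniz' formula `Matrix.det_apply'` applied to the
first two conjuncts of `two_twists_four_data`): `det A = det B = 98`. [this file] -/
theorem two_twists_four_det (A B : Matrix (Fin 4) (Fin 4) ℤ)
    (hA : A = !![1, -2, 1, 2; 2, 1, -2, 1; -2, 1, -1, 2; -1, -2, -2, -1])
    (hB : B = !![2, 1, -2, -1; 1, -2, 1, -2; 1, 2, 2, -1; -2, 1, -1, -2]) :
    A.det = 98 ∧ B.det = 98 := by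
  obtain ⟨h1, h2, -⟩ := two_twists_four_data A B hA hB
  refine ⟨?_, ?_⟩
  · rw [Matrix.det_apply']
    simpa [Units.smul_def] using h1
  · rw [Matrix.det_apply']
    simpa [Units.smul_def] using h2

/-- **Forster's slice inequality is TIGHT at this witness**: with `K = 24·(1122+1122)/196²` the
landed `forsterSlice_of_isotropyConstant` concludes `24·per(V∘V) ≤ K·2·det(V)²` for a term `V`;
here both twists give equality, `24·1122·196² = (24·2244)·2·98²` as an identity of integers.
[this file] -/
theorem two_twists_four_forster_tight :
    (24 : ℤ) * 1122 * 196 ^ 2 = (24 * (1122 + 1122)) * 2 * 98 ^ 2 := by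
  norm_num

end Summit.ValiantsHypothesis.ValiantsHypothesis.Theorems.SliceSignRank.SrkNotQP
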